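import Mathlib
import Summits.HodgeConjecture.FermatCycles.HodgeFermatTheoremU
import Summits.HodgeConjecture.FermatCycles.HodgeFermatLattice
import Summits.HodgeConjecture.FermatCycles.HodgeFermatCorollaryUStatement
import Summits.HodgeConjecture.HodgeConjecture.Theorems.FermatCyclesAokiMatchAllLevelsGapVec

/-!
# COROLLARY U′ — all-unit Hodge multisets with at most six distinct residues are SUMS OF PAIRS, from LEMMA W (`HodgeFermat/CorollaryUPrime.lean`; HF-G27)

Tree copy of the module `HodgeFermat/CorollaryUPrime.lean` of the sibling cell's standalone package
`run/shared/lean/pub/pub-hodgefermat/lean/HodgeFermat/` (369 lines, sha256 `e1ce3070c5d6fd4e…`), source lines 34–57, 68–268 and 275–369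
(the hypothesis `HypWPlus'` — verbatim copy of the landed `HypUPlus.HypWPlus` —, `EvenAt`, the weight form `evenAt_of_lemmaW`, the
multiset form `count_neg_eq_count_of_lemmaW`, the splitting `isSumOfPairs_of_count`, `reach_of_isSumOfPairs`, and COROLLARY U′ from
LEMMA W: `corUPrime_of : HypWPlus' → CorUPrime`, `reach_of`, `quadruple_of`, `sextuple_of`) — pub-hodgefermat `CERT.md` l.912, GATE HF-G27;
cell record `check/CorUPrime_standalone.lean` (hub `lean check` rc 0, `--axioms …corUPrime_of` = the trio).  The statement
`IsSumOfPairs`/`CorUPrime` (source l.58–66) was filed first (`HodgeFermatCorollaryUStatement.lean`, same namespace); the hypothesis is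
discharged in `HodgeFermatCorollaryUPrimeFinal.lean` by the landed LEMMA W⁺ `HypUPlus.hypWPlus` (`HodgeFermatPropDPrimeNFinal.lean`).
Filed by cell `pub-hfermat`, seat prover-1 gen-5, on the COORDINATOR KEEPER RULING of 2026-08-25 (gem sweep H1: take the
off-gate kernel theorem `thmFstar` through the gate; every form of THEOREM F* is on-gate since 2026-08-25/26, gen-0/2/3/4), as
successor work of the same verbatim-port kind: the sibling's off-gate gate records HF-G27 / HF-G27b / HF-G27c — COROLLARY U′
(all-unit Hodge multisets with few distinct residues are sums of pairs), its printed-threshold forms U♯, and THEOREM U in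
shared-entry form — on top of the landed LEMMA W / THEOREM U / U⁺ / U⁼ chain (`HodgeFermatTheoremU.lean`,
`HodgeFermatLemmaWFourier.lean`, `HodgeFermatTheoremUPlus.lean`, `HodgeFermatTheoremUEq.lean`, `HodgeFermatPropDPrimeNFinal.lean`).
Deviations from the source module, exhaustively: the `import` lines (`…HodgeFermatTheoremU` for `import HodgeFermat.TheoremU`,
`…HodgeFermatLattice` for `import HodgeFermat.Lattice`, `…HodgeFermatCorollaryUStatement` for the two definitions filed first, NOT
re-declared here, and `Summits.HodgeConjecture.HodgeConjecture.Theorems.FermatCyclesAokiMatchAllLevelsGapVec` for the DEDUP re-binding);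
this docstring (replacing the module docstring, quoted below); one-line docstrings added (gate lint) to `cw_of_lt`, `cw_of_le`,
`count_pair`; ONE DEDUP deletion (the gate's `dedup.landed`, dry-run of 2026-08-26T03:1xZ), re-bound so that both use sites stay
byte-identical: the source's `lemma count_neg_pair` (l.269–273, `count (-x) {a, -a} = count x {a, -a}`) restates the landed
`Summit.HodgeConjecture.HodgeConjecture.FermatCycles.AokiMatch.count_pair_neg` (`Summits/HodgeConjecture/HodgeConjecture/Theorems/
FermatCyclesAokiMatchAllLevelsGapVec.lean`, another cell of this summit) and is NOT re-declared — it is brought into scope by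
`open Summit.HodgeConjecture.HodgeConjecture.FermatCycles.AokiMatch renaming count_pair_neg → count_neg_pair`.  Every other line — in
particular every declaration's statement and proof — is byte-identical to the source.
Trust base: hypothesis `HypWPlus'` displayed where used, no `sorry`; axioms = [propext, Classical.choice, Quot.sound].
HONEST FRAMING: explicit algebraic cycles for specific Hodge classes on Fermat/Delsarte varieties; residual open instances
listed; no claim on general Hodge.  (This file is arithmetic of CM types / finite combinatorics of the sibling's KR-free
programme; it claims nothing about cycles.)

The docstring of `HodgeFermat/CorollaryUPrime.lean` (l.7–32), verbatim:

## COROLLARY U′ — all-unit Hodge multisets with at most six distinct residues are SUMS OF PAIRS (HF-G27)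

`tables/SEMI-THEOREM.md` §2, COROLLARY U′ ("for m ∉ {21, 39} every all-unit Hodge multiset with at most 6 distinct
residues is a sum of pairs … [Proof: as above with w = v: … #supp w⁻ ≤ 2·#supp v, uncertainty principle ⟹ w⁻ = 0]"),
so far by hand, here as a kernel theorem downstream of LEMMA W.  At a level `N` where LEMMA W holds (`TheoremU.LemmaW`:
an odd integer weight on the units of `ℤ/N` supported on at most `12` residues whose residue transform vanishes at
every unit is zero — generation 26: every odd `N > 1`, `N ∉ {21, 39}`, `HypUPlus.hypWPlus`):

* `evenAt_of_lemmaW` (weight form): an integer weight `v` on the units mod `N`, supported on at most SIX residues and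
  satisfying the Hodge length equations `2 Σ_x v(x)⟨tx⟩ = N Σ_x v(x)` at every unit `t`, is EVEN, `v(N − x) = v(x)`
  (apply LEMMA W to `w = v − v(N − ·)`: odd, support `≤ 12`, transform `2 Σ v⟨tx⟩ − N Σ v = 0`);
* `count_neg_eq_count_of_lemmaW` (multiset form): a Hodge multiset `s` over `ℤ/N` (`IsHodgeMultiset`, the vendored
  `Literature` predicate: non-zero entries, zero sum, `2 Σ⟨ta⟩ = N · #s` for all units `t`) all of whose entries are
  UNITS and which has at most six distinct entries takes every value as often as its negative;
* `isSumOfPairs_of_count`: at odd `N` such a multiset is a sum of pairs `{a, −a}` (split off pairs,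
  `IsHodgeMultiset.exists_eq_pair_add_of_count`), hence ℤ-reachable from the printed supply (`reach_of_isSumOfPairs`);
* `CorUPrime` / `corUPrime_of`: at every odd `N ∉ {21, 39}`, every all-unit Hodge multiset with at most six distinct
  residues is a sum of pairs — in particular every all-unit Hodge QUADRUPLE is two pairs (`quadruple_of`) and every
  all-unit Hodge SEXTUPLE (e.g. a semi-decomposable one, type `X¹ × X¹`) is three pairs (`sextuple_of`).

The hypothesis is carried as `HypWPlus'`, a VERBATIM copy of the body of `HypUPlus.HypWPlus`; `CorollaryUPrimeFinal.lean`
checks `HypWPlus' ↔ HypWPlus` by `Iff.rfl` and feeds generation 26's `hypWPlus`.  Hub records: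
`check/CorUPrime_standalone.lean` (`--axioms HodgeFermat.KRFree.CorollaryUPrime.corUPrime_of` = the three) and the link check
`check/CorUPrimeLink_standalone.lean`.  Paper §1 (xiv); `tables/SEMI-THEOREM.md` §2.
-/

set_option autoImplicit false

namespace HodgeFermat.KRFree.CorollaryUPrime

open Finset HodgeFermat.KRFree.LemmaN HodgeFermat.KRFree.TheoremU
open Literature.AlgebraicGeometry.HodgeTheory.FermatCharacter
open Summit.HodgeConjecture.HodgeConjecture.FermatCycles.AokiMatch renaming count_pair_neg → count_neg_pair

/-! ## Statements -/

/-- VERBATIM copy of the body of `HodgeFermat.KRFree.HypUPlus.HypWPlus` (`TheoremUPlus.lean`, generation 26):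
LEMMA W at every odd level `N > 1`, `N ∉ {21, 39}`. -/
def HypWPlus' : Prop := ∀ N, 1 < N → ¬ 2 ∣ N → N ≠ 21 → N ≠ 39 → LemmaW N

/-- COROLLARY U′ at level `N`, WEIGHT form: an integer weight on the units of `ℤ/N` (zero off `[0, N)` and off the
units), supported on at most six residues, which satisfies the Hodge length equations `2 Σ_x v(x)⟨tx⟩_N = N Σ_x v(x)`
at every unit `t`, is even: `v(N − x) = v(x)`. -/
def EvenAt (N : ℕ) : Prop :=
  ∀ v : ℕ → ℤ,
    (∀ x, N ≤ x → v x = 0) →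
    (∀ x, ¬ Nat.Coprime x N → v x = 0) →
    ((Finset.range N).filter (fun x => v x ≠ 0)).card ≤ 6 →
    (∀ t, Nat.Coprime t N → 2 * resTransform N v t = (N : ℤ) * ∑ x ∈ Finset.range N, v x) →
    ∀ x, x < N → v (N - x) = v x

-- `def IsSumOfPairs`, `def CorUPrime` (source l.58–66): filed first, `HodgeFermatCorollaryUStatement.lean` (same namespace).

/-! ## The weight form from LEMMA W -/

/-- the odd part `y ↦ v(y) − v(N − y)` of a weight -/
def oddPart (N : ℕ) (v : ℕ → ℤ) (y : ℕ) : ℤ := v y - v (N - y)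

/-- reflection `y ↦ N − y` in a residue-transform sum (the boundary terms vanish because `v 0 = v N = 0`) -/
lemma sum_reflect {N : ℕ} (v : ℕ → ℤ) (g : ℕ → ℤ) (hv0 : v 0 = 0) (hvN : v N = 0) :
    ∑ y ∈ Finset.range N, v (N - y) * g y = ∑ y ∈ Finset.range N, v y * g (N - y) := by
  have e1 : ∑ y ∈ Finset.range (N + 1), v (N - y) * g y = ∑ y ∈ Finset.range N, v (N - y) * g y := by
    rw [Finset.sum_range_succ, Nat.sub_self, hv0, zero_mul, add_zero]
  have e2 : ∑ y ∈ Finset.range (N + 1), v y * g (N - y) = ∑ y ∈ Finset.range N, v y * g (N - y) := by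
    rw [Finset.sum_range_succ, hvN, zero_mul, add_zero]
  rw [← e1, ← e2, ← Finset.sum_flip (fun y => v y * g (N - y))]
  refine Finset.sum_congr rfl fun y hy => ?_
  have hy' : y ≤ N := by have := Finset.mem_range.mp hy; omega
  simp only [Nat.sub_sub_self hy']

/-- **COROLLARY U′, weight form, from LEMMA W at `N > 1`.** -/
theorem evenAt_of_lemmaW {N : ℕ} (h1 : 1 < N) (hW : LemmaW N) : EvenAt N := by
  intro v hvN hvu hcard hH
  have hN : 0 < N := by omega
  have hv0 : v 0 = 0 := hvu 0 (by intro h; rw [Nat.coprime_zero_left] at h; omega)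
  -- LEMMA W applied to the odd part `w = v − v(N − ·)`
  have hwN : ∀ y, N ≤ y → oddPart N v y = 0 := by
    intro y hy
    simp only [oddPart, hvN y hy, Nat.sub_eq_zero_of_le hy, hv0, sub_zero]
  have hwu : ∀ y, ¬ Nat.Coprime y N → oddPart N v y = 0 := by
    intro y hy
    have h2 : v (N - y) = 0 := by
      rcases Nat.lt_or_ge y N with hlt | hge
      · refine hvu _ fun hc => hy ?_
        have := coprime_sub (Nat.sub_le N y) hc
        rwa [Nat.sub_sub_self hlt.le] at this
      · rw [Nat.sub_eq_zero_of_le hge, hv0]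
    simp only [oddPart, hvu y hy, h2, sub_zero]
  have hwodd : ∀ y, 0 < y → y < N → oddPart N v (N - y) = - oddPart N v y := by
    intro y _ hy
    simp only [oddPart, Nat.sub_sub_self hy.le]
    ring
  have hwcard : ((Finset.range N).filter (fun y => oddPart N v y ≠ 0)).card ≤ 12 := by
    set S := (Finset.range N).filter (fun x => v x ≠ 0) with hS
    have hsub : (Finset.range N).filter (fun y => oddPart N v y ≠ 0) ⊆ S ∪ S.image (fun x => N - x) := by
      intro y hy
      rw [Finset.mem_filter, Finset.mem_range] at hy
      rw [Finset.mem_union]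
      by_cases hvy : v y = 0
      · right
        have hvy' : v (N - y) ≠ 0 := by
          intro h0; apply hy.2; simp only [oddPart, hvy, h0, sub_zero]
        have hy0 : 0 < y := by
          rcases Nat.eq_zero_or_pos y with rfl | h
          · exact absurd (by rw [Nat.sub_zero]; exact hvN N le_rfl) hvy'
          · exact h
        refine Finset.mem_image.mpr ⟨N - y, Finset.mem_filter.mpr ⟨Finset.mem_range.mpr (by omega), hvy'⟩, ?_⟩
        exact Nat.sub_sub_self hy.1.le
      · exact Or.inl (Finset.mem_filter.mpr ⟨Finset.mem_range.mpr hy.1, hvy⟩)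
    calc ((Finset.range N).filter (fun y => oddPart N v y ≠ 0)).card
        ≤ (S ∪ S.image (fun x => N - x)).card := Finset.card_le_card hsub
      _ ≤ S.card + (S.image (fun x => N - x)).card := Finset.card_union_le _ _
      _ ≤ S.card + S.card := Nat.add_le_add_left Finset.card_image_le _
      _ ≤ 12 := by have : S.card ≤ 6 := hcard; omega
  have hwT : ∀ t, Nat.Coprime t N → resTransform N (oddPart N v) t = 0 := by
    intro t ht
    -- `Σ_y v(N − y)⟨ty⟩ = Σ_y v(y)⟨t(N − y)⟩ = Σ_y v(y)(N − ⟨ty⟩)` (the last because `v` lives on the units)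
    have hrefl := sum_reflect v (fun y => ((t * y % N : ℕ) : ℤ)) hv0 (hvN N le_rfl)
    have hneg : ∀ y ∈ Finset.range N,
        v y * ((t * (N - y) % N : ℕ) : ℤ) = v y * ((N : ℤ) - ((t * y % N : ℕ) : ℤ)) := by
      intro y hy
      have hy' := Finset.mem_range.mp hy
      by_cases hvy : v y = 0
      · rw [hvy, zero_mul, zero_mul]
      · have hyu : Nat.Coprime y N := by by_contra hc; exact hvy (hvu y hc)
        have hres : ((t * (N - y) % N : ℕ) : ℤ) + ((t * y % N : ℕ) : ℤ) = (N : ℤ) := by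
          exact_mod_cast neg_res hN hy'.le (not_dvd_of_coprime h1 (Nat.coprime_mul_iff_left.mpr ⟨ht, hyu⟩))
        congr 1
        linarith
    have eT : ∑ y ∈ Finset.range N, v y * ((N : ℤ) - ((t * y % N : ℕ) : ℤ))
        = (N : ℤ) * (∑ y ∈ Finset.range N, v y) - ∑ y ∈ Finset.range N, v y * ((t * y % N : ℕ) : ℤ) := by
      rw [Finset.mul_sum, ← Finset.sum_sub_distrib]
      exact Finset.sum_congr rfl fun y _ => by ring
    have key : resTransform N (oddPart N v) t
        = 2 * resTransform N v t - (N : ℤ) * ∑ y ∈ Finset.range N, v y := by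
      unfold resTransform
      have step : ∑ y ∈ Finset.range N, oddPart N v y * ((t * y % N : ℕ) : ℤ)
          = ∑ y ∈ Finset.range N, v y * ((t * y % N : ℕ) : ℤ) - ∑ y ∈ Finset.range N, v (N - y) * ((t * y % N : ℕ) : ℤ) := by
        rw [← Finset.sum_sub_distrib]
        exact Finset.sum_congr rfl fun y _ => by simp only [oddPart]; ring
      rw [step, hrefl, Finset.sum_congr rfl hneg, eT]
      ring
    rw [key, hH t ht]
    ring
  have hzero := hW (oddPart N v) hwN hwu hwodd hwcard hwT
  intro x _
  have hx := hzero x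
  simp only [oddPart] at hx
  linarith

/-! ## The multiset form -/

/-- the multiplicity weight of a multiset of residues: `x ↦ #{occurrences of x in s}` on `[0, N)`, `0` beyond -/
def cw {N : ℕ} (s : Multiset (ZMod N)) (x : ℕ) : ℤ := if x < N then (s.count (x : ZMod N) : ℤ) else 0

/-- `cw s x` below `N` is the multiplicity of the residue `x` -/
lemma cw_of_lt {N : ℕ} (s : Multiset (ZMod N)) {x : ℕ} (hx : x < N) : cw s x = s.count (x : ZMod N) := if_pos hx

/-- `cw s x = 0` from `N` on -/
lemma cw_of_le {N : ℕ} (s : Multiset (ZMod N)) {x : ℕ} (hx : N ≤ x) : cw s x = 0 := if_neg (by omega)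

/-- a sum over `ℤ/N` is a sum over the representatives `0, …, N − 1` -/
lemma sum_zmod_eq_sum_range {N : ℕ} [NeZero N] {β : Type*} [AddCommMonoid β] (F : ZMod N → β) :
    ∑ m : ZMod N, F m = ∑ x ∈ Finset.range N, F (x : ZMod N) := by
  refine (Finset.sum_nbij' (fun x : ℕ => (x : ZMod N)) (fun m : ZMod N => m.val) ?_ ?_ ?_ ?_ ?_).symm
  · intro x _; exact Finset.mem_univ _
  · intro m _; exact Finset.mem_range.mpr (ZMod.val_lt m)
  · intro x hx
    show (x : ZMod N).val = x
    rw [ZMod.val_natCast, Nat.mod_eq_of_lt (Finset.mem_range.mp hx)]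
  · intro m _; exact ZMod.natCast_zmod_val m
  · intro x _; rfl

/-- at odd `N`, a self-negative residue is zero (`2` is a unit) -/
lemma eq_zero_of_eq_neg {N : ℕ} (hodd : ¬ 2 ∣ N) {b : ZMod N} (h : b = -b) : b = 0 := by
  have h2 : (2 : ZMod N) * b = 0 := by
    rw [two_mul]; nth_rw 2 [h]; exact add_neg_cancel b
  have hu : IsUnit ((2 : ℕ) : ZMod N) :=
    (ZMod.isUnit_iff_coprime 2 N).mpr ((Nat.Prime.coprime_iff_not_dvd Nat.prime_two).mpr hodd)
  rw [Nat.cast_ofNat] at hu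
  exact hu.mul_right_eq_zero.mp h2

/-- **COROLLARY U′, multiset form, from LEMMA W at `N > 1`**: an all-unit Hodge multiset with at most six distinct
entries takes every value as often as its negative. -/
theorem count_neg_eq_count_of_lemmaW {N : ℕ} (h1 : 1 < N) (hW : LemmaW N) {s : Multiset (ZMod N)}
    (hs : IsHodgeMultiset s) (hu : ∀ a ∈ s, IsUnit a) (h6 : s.toFinset.card ≤ 6) (a : ZMod N) :
    s.count (-a) = s.count a := by
  haveI : NeZero N := ⟨by omega⟩
  -- the multiplicity weight satisfies the hypotheses of the weight form
  have hv0 : ∀ x, N ≤ x → cw s x = 0 := fun x hx => cw_of_le s hx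
  have hvu : ∀ x, ¬ Nat.Coprime x N → cw s x = 0 := by
    intro x hx
    rcases Nat.lt_or_ge x N with hlt | hge
    · rw [cw_of_lt s hlt, Nat.cast_eq_zero]
      exact Multiset.count_eq_zero.mpr fun hmem => hx ((ZMod.isUnit_iff_coprime x N).mp (hu _ hmem))
    · exact cw_of_le s hge
  have hcard : ((Finset.range N).filter (fun x => cw s x ≠ 0)).card ≤ 6 := by
    refine le_trans ?_ h6
    refine Finset.card_le_card_of_injOn (fun x : ℕ => (x : ZMod N)) ?_ ?_
    · intro x hx
      rw [Finset.mem_coe, Finset.mem_filter, Finset.mem_range] at hx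
      rw [Finset.mem_coe, Multiset.mem_toFinset]
      have hne : s.count (x : ZMod N) ≠ 0 := by
        have h := hx.2
        rwa [cw_of_lt s hx.1, Nat.cast_ne_zero] at h
      exact Multiset.count_ne_zero.mp hne
    · intro x hx y hy hxy
      rw [Finset.mem_coe, Finset.mem_filter, Finset.mem_range] at hx hy
      have h := (ZMod.natCast_eq_natCast_iff' x y N).mp hxy
      rwa [Nat.mod_eq_of_lt hx.1, Nat.mod_eq_of_lt hy.1] at h
  have hH : ∀ t, Nat.Coprime t N →
      2 * resTransform N (cw s) t = (N : ℤ) * ∑ x ∈ Finset.range N, cw s x := by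
    intro t ht
    have h := hs.2 (ZMod.unitOfCoprime t ht)
    rw [ZMod.coe_unitOfCoprime] at h
    -- `h : 2 * mNormSum (s.map (t * ·)) = N * #s` in `ℕ`; both sides are the two sides of the claim
    have e1N : mNormSum (s.map fun a => (t : ZMod N) * a)
        = ∑ x ∈ Finset.range N, s.count (x : ZMod N) * (t * x % N) := by
      unfold mNormSum
      rw [Multiset.map_map, sum_map_eq_sum_count_mul, sum_zmod_eq_sum_range]
      refine Finset.sum_congr rfl fun x _ => ?_
      rw [Function.comp_apply, ← Nat.cast_mul, ZMod.val_natCast]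
    have e1 : ((mNormSum (s.map fun a => (t : ZMod N) * a) : ℕ) : ℤ) = resTransform N (cw s) t := by
      rw [e1N, Nat.cast_sum]
      unfold resTransform
      refine Finset.sum_congr rfl fun x hx => ?_
      rw [cw_of_lt s (Finset.mem_range.mp hx), Nat.cast_mul]
    have e2 : ((Multiset.card s : ℕ) : ℤ) = ∑ x ∈ Finset.range N, cw s x := by
      rw [card_eq_sum_count, Nat.cast_sum, sum_zmod_eq_sum_range]
      exact Finset.sum_congr rfl fun x hx => by rw [cw_of_lt s (Finset.mem_range.mp hx)]
    have h' : (2 : ℤ) * ((mNormSum (s.map fun a => (t : ZMod N) * a) : ℕ) : ℤ)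
        = (N : ℤ) * ((Multiset.card s : ℕ) : ℤ) := by exact_mod_cast h
    rw [e1, e2] at h'
    exact h'
  have heven := evenAt_of_lemmaW h1 hW (cw s) hv0 hvu hcard hH
  -- read off the multiplicities of `a` and `−a`
  by_cases ha0 : a = 0
  · rw [ha0, neg_zero]
  · have hx : a.val < N := ZMod.val_lt a
    have hpos : 0 < a.val := by
      rcases Nat.eq_zero_or_pos a.val with h | h
      · exact absurd ((ZMod.val_eq_zero a).mp h) ha0
      · exact h
    have key := heven a.val hx
    rw [cw_of_lt s (by omega : N - a.val < N), cw_of_lt s hx, Nat.cast_inj, ZMod.natCast_zmod_val] at key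
    have e : ((N - a.val : ℕ) : ZMod N) = -a := by
      rw [Nat.cast_sub hx.le, ZMod.natCast_self, ZMod.natCast_zmod_val, zero_sub]
    rw [e] at key
    exact key

/-! ## Splitting into pairs -/

/-- multiplicities in the pair `{a, −a}` -/
lemma count_pair {N : ℕ} (a x : ZMod N) :
    Multiset.count x ({a, -a} : Multiset (ZMod N)) = (if x = a then 1 else 0) + (if x = -a then 1 else 0) := by
  rw [Multiset.insert_eq_cons, Multiset.count_cons, Multiset.count_singleton, add_comm]

-- `lemma count_neg_pair` (source l.269–273, «the pair `{a, −a}` is symmetric»): NOT re-declared — its statement is the landed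
-- `Summit.HodgeConjecture.HodgeConjecture.FermatCycles.AokiMatch.count_pair_neg`, renamed into scope above (DEDUP, gate `dedup.landed`).

/-- **Symmetric all-non-zero Hodge multisets at odd level are sums of pairs** (induction on the size: split off
`{a, −a}` with `IsHodgeMultiset.exists_eq_pair_add_of_count`; no entry is self-negative at odd `N`). -/
theorem isSumOfPairs_of_count {N : ℕ} [NeZero N] (hodd : ¬ 2 ∣ N) (n : ℕ) :
    ∀ s : Multiset (ZMod N), Multiset.card s ≤ n → IsHodgeMultiset s →
      (∀ a, s.count (-a) = s.count a) → IsSumOfPairs s := by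
  induction n with
  | zero =>
    intro s hn _ _
    have hs0 : s = 0 := Multiset.card_eq_zero.mp (Nat.le_zero.mp hn)
    exact ⟨0, fun a ha => by simp at ha, by simp [hs0]⟩
  | succ n ih =>
    intro s hn hs hsym
    by_cases h0 : s = 0
    · exact ⟨0, fun a ha => by simp at ha, by simp [h0]⟩
    · obtain ⟨a, t, ha, ht, rfl⟩ := hs.exists_eq_pair_add_of_count h0 hsym
        (fun b hb hbn => absurd (eq_zero_of_eq_neg hodd hbn) (hs.1.1 b hb))
      have htsym : ∀ b, t.count (-b) = t.count b := fun b => by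
        have h := hsym b
        rw [Multiset.count_add, Multiset.count_add, count_neg_pair] at h
        omega
      have htn : Multiset.card t ≤ n := by
        have h := hn
        simp only [Multiset.card_add, Multiset.insert_eq_cons, Multiset.card_cons,
          Multiset.card_singleton] at h
        omega
      obtain ⟨P, hP, rfl⟩ := ih t htn ht htsym
      refine ⟨a ::ₘ P, fun b hb => ?_, by rw [Multiset.map_cons, Multiset.sum_cons]⟩
      rcases Multiset.mem_cons.mp hb with rfl | hb
      · exact ha
      · exact hP b hb

/-- a sum of pairs is ℤ-reachable (indeed ℕ-reachable: no negative part) from the printed supply of its level -/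
theorem reach_of_isSumOfPairs {N : ℕ} {s : Multiset (ZMod N)} (h : IsSumOfPairs s) : Reach N s := by
  obtain ⟨P, hP, rfl⟩ := h
  refine ⟨P.map fun a => ({a, -a} : Multiset (ZMod N)), 0, ?_, fun u hu => by simp at hu, by simp⟩
  intro u hu
  obtain ⟨a, ha, rfl⟩ := Multiset.mem_map.mp hu
  exact pair_mem_supply a (hP a ha)

/-- a sum of pairs has symmetric multiplicities (the easy converse) -/
theorem count_neg_eq_count_of_isSumOfPairs {N : ℕ} {s : Multiset (ZMod N)} (h : IsSumOfPairs s) (x : ZMod N) :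
    s.count (-x) = s.count x := by
  obtain ⟨P, -, rfl⟩ := h
  induction P using Multiset.induction_on with
  | empty => simp
  | cons a P ih => rw [Multiset.map_cons, Multiset.sum_cons, Multiset.count_add, Multiset.count_add, ih,
      count_neg_pair]

/-! ## COROLLARY U′ -/

/-- **COROLLARY U′ at a level `N > 1` where LEMMA W holds, `N` odd.** -/
theorem isSumOfPairs_of_lemmaW {N : ℕ} (h1 : 1 < N) (hodd : ¬ 2 ∣ N) (hW : LemmaW N)
    {s : Multiset (ZMod N)} (hs : IsHodgeMultiset s) (hu : ∀ a ∈ s, IsUnit a) (h6 : s.toFinset.card ≤ 6) :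
    IsSumOfPairs s := by
  haveI : NeZero N := ⟨by omega⟩
  exact isSumOfPairs_of_count hodd (Multiset.card s) s le_rfl hs (count_neg_eq_count_of_lemmaW h1 hW hs hu h6)

/-- **COROLLARY U′ from LEMMA W⁺** (the hub-checked content of this module). -/
theorem corUPrime_of (hW : HypWPlus') : CorUPrime := by
  intro N h2 h21 h39 s hs hu h6
  rcases Nat.lt_or_ge 1 N with h1 | hN1
  · exact isSumOfPairs_of_lemmaW h1 h2 (hW N h1 h2 h21 h39) hs hu h6
  · -- `N = 0` is even; at `N = 1` every residue is `0`, so a Hodge multiset is empty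
    have hN : N = 1 := by
      rcases Nat.eq_zero_or_pos N with rfl | hpos
      · exact absurd (dvd_zero 2) h2
      · omega
    subst hN
    have hs0 : s = 0 := by
      rcases Multiset.empty_or_exists_mem s with h | ⟨a, ha⟩
      · exact h
      · exact absurd ((ZMod.val_eq_zero a).mp (by have := ZMod.val_lt a; omega)) (hs.1.1 a ha)
    exact ⟨0, fun a ha => by simp at ha, by simp [hs0]⟩

/-- every all-unit Hodge multiset with at most six distinct residues, at an odd level `N ∉ {21, 39}`, is
ℤ-reachable from the printed supply of its own level (pairs only). -/
theorem reach_of (hW : HypWPlus') (N : ℕ) (h2 : ¬ 2 ∣ N) (h21 : N ≠ 21) (h39 : N ≠ 39)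
    (s : Multiset (ZMod N)) (hs : IsHodgeMultiset s) (hu : ∀ a ∈ s, IsUnit a) (h6 : s.toFinset.card ≤ 6) :
    Reach N s :=
  reach_of_isSumOfPairs (corUPrime_of hW N h2 h21 h39 s hs hu h6)

/-- **All-unit Hodge QUADRUPLES are two pairs** (odd `N ∉ {21, 39}`). -/
theorem quadruple_of (hW : HypWPlus') (N : ℕ) (h2 : ¬ 2 ∣ N) (h21 : N ≠ 21) (h39 : N ≠ 39)
    (s : Multiset (ZMod N)) (hs : IsHodgeMultiset s) (hu : ∀ a ∈ s, IsUnit a) (h4 : Multiset.card s = 4) :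
    IsSumOfPairs s :=
  corUPrime_of hW N h2 h21 h39 s hs hu ((Multiset.toFinset_card_le (m := s)).trans (by omega))

/-- **All-unit Hodge SEXTUPLES are three pairs** (odd `N ∉ {21, 39}`) — in particular the semi-decomposable ones
(type `X¹ × X¹`: two zero-sum triples of units), which is THEOREM S6 (1) for all-unit sextuples at these levels. -/
theorem sextuple_of (hW : HypWPlus') (N : ℕ) (h2 : ¬ 2 ∣ N) (h21 : N ≠ 21) (h39 : N ≠ 39)
    (s : Multiset (ZMod N)) (hs : IsHodgeMultiset s) (hu : ∀ a ∈ s, IsUnit a) (h6 : Multiset.card s = 6) :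
    IsSumOfPairs s :=
  corUPrime_of hW N h2 h21 h39 s hs hu ((Multiset.toFinset_card_le (m := s)).trans (by omega))

end HodgeFermat.KRFree.CorollaryUPrime
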